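import Literature.AnabelianGeometry.EtaleTheta.SettingModelKrullCoverings
import Literature.AnabelianGeometry.EtaleTheta.SettingModelChiSemidirect
import HarnessLib

/-!
# The UNTWISTED KRULL model of the [EtTh] §1 root, file K1b: the tempered group `Π^tp_X := Γ ⋊_{θ∘1} G_{ℚ_p}`,
# its profinite completion `Π_X := F̂₂ ⋊_{θ∘1} G_{ℚ_p}`, and the `TemperedCurve` inhabitant `curveκ`

Mochizuki, *The étale theta function …*, Publ. RIMS **45** (2009) [EtTh], §1, PRIMS PDF pp. 11–13
[cite: MochizukiEtTh2009, §1 p.12]: «`1 → Δ^tp_X → Π^tp_X → G_K → 1`», «`Δ_X` … the profinite completion of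
`Δ^tp_X` … a profinite free group on 2 generators», «`Π^tp_X ↠ Z`». Cell abc-iut, layer L2, seat abc-iut-L2-t10
(gen 5), row «coverDataAx FULLY INSTANTIATED», file K1b: abc-iut-w5-d249's F4 carrier `SettingModelChiSemidirect`
TRANSCRIBED VERBATIM with the cyclotomic character `χ` replaced by the trivial homomorphism `1 : G_{ℚ_p} → Ẑ^×`
(K1a `SettingModelKrullCoverings`: `actκ := twistGfp ∘ 1`, the action is the identity, `actκ_apply_eq`): `PiTpκ`,
`PiHtκ` with the induced topologies (compact/T2/totally disconnected hat side), `augκ`, `toHatκ` a profinite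
completion, **`curveκ p : TemperedCurve p`** (`K := ℚ_p`, no closed point — the cusped variant is K3), and
`deltaHatκ_eq : Δ̂_X = Ker(Π_X → G_{ℚ_p})` ((P1) on the nose, Krull factor), `deltaHatκEquiv : F̂₂ ≃ₜ* Δ̂_X`,
`isFreeProfiniteOnTwo_deltaHatκ`. SEMI-SYNTHETIC (consistency evidence only; trivial Galois action on `Γ`; NOT the
tempered `π₁` of a curve). Class (b): instances on the NEW carriers `PiTpκ`/`PiHtκ` only; no `Prop` fact; nothing of
[EtTh] asserted; no side taken on [IUTchIII] Cor. 3.12; typed ≠ proved.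
-/

noncomputable section

namespace Literature.AnabelianGeometry.EtaleTheta.SettingModel

open Literature.AnabelianGeometry.SemiGraphs _root_.Topology _root_.Function

variable (p : ℕ) [Fact p.Prime]

/-! ### `Π^tp_X := Γ ⋊_κ G_{ℚ_p}` -/

/-- **`Π^tp_X` of the κ-twisted model**: `Γ ⋊_{actκ} G_{ℚ_p}`, `Γ = F̂₂ ×_Ẑ ℤ`, `actκ σ = θ_{κ(σ)} × id`.
[cite: MochizukiEtTh2009, §1 p.12] -/
abbrev PiTpκ : Type := Gfp ⋊[actκ p] GQp p

/-- The topology of `Π^tp_X`: induced along `g ↦ (g.left, g.right) ∈ Γ × G_{ℚ_p}`.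
[cite: MochizukiEtTh2009, §1 p.12] -/
instance instTopologicalSpacePiTpκ : TopologicalSpace (PiTpκ p) :=
  TopologicalSpace.induced (fun g : PiTpκ p => (g.left, g.right)) inferInstance

/-- `g ↦ (g.left, g.right)` is inducing (by definition of the topology). [cite: MochizukiEtTh2009, §1 p.12] -/
theorem isInducing_leftRightκ : IsInducing fun g : PiTpκ p => (g.left, g.right) := ⟨rfl⟩

/-- `g ↦ (g.left, g.right)` is continuous (export for abc-iut-L2-t1's `isOpen_YNκ` / `isOpen_ZNκ`).
[cite: MochizukiEtTh2009, §1 p.12] -/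
theorem continuous_leftRightκ : Continuous fun g : PiTpκ p => (g.left, g.right) :=
  (isInducing_leftRightκ p).continuous

/-- **The twisting action is jointly continuous**: `(σ, γ) ↦ θ_{κ(σ)} γ` on `G_{ℚ_p} × Γ` (abc-iut-w5-d024's
level-wise argument + local constancy of `κ_N`). [cite: MochizukiEtTh2009, §1 p.12] -/
theorem continuous_actκ : Continuous fun q : GQp p × Gfp => actκ p q.1 q.2 :=
  continuous_twistGfp_of_isLocallyConstant (fun σ => (1 : GQp p →* MulAut ZH) σ)
    (fun N => by
      have h : (fun σ : GQp p => ZHatLevel.levelChar N ((1 : GQp p →* MulAut ZH) σ)) = fun _ => 1 := by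
        funext σ; rw [MonoidHom.one_apply, map_one]
      rw [h]; exact IsLocallyConstant.const 1)

/-- **`Π^tp_X` is a topological group.** [cite: MochizukiEtTh2009, §1 p.12] -/
instance instIsTopologicalGroupPiTpκ : IsTopologicalGroup (PiTpκ p) :=
  Semidirect.isTopologicalGroup_of_continuous_action (isInducing_leftRightκ p) (continuous_actκ p)

/-- `Γ ↪ Π^tp_X` is continuous. [cite: MochizukiEtTh2009, §1 p.12] -/
theorem continuous_inlκ : Continuous (SemidirectProduct.inl : Gfp → PiTpκ p) :=
  Semidirect.continuous_inl (isInducing_leftRightκ p)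

/-- The section `G_{ℚ_p} ↪ Π^tp_X` is continuous. [cite: MochizukiEtTh2009, §1 p.12] -/
theorem continuous_inrκ : Continuous (SemidirectProduct.inr : GQp p → PiTpκ p) :=
  Semidirect.continuous_inr (isInducing_leftRightκ p)

/-- **The augmentation `Π^tp_X → G_{ℚ_p}`** of the κ-twisted model: `g ↦ g.right`. [cite: MochizukiEtTh2009, §1 p.12] -/
def augκ : PiTpκ p →ₜ* GQp p := Semidirect.rightHomCont (isInducing_leftRightκ p)

/-- [cite: MochizukiEtTh2009, §1 p.12] -/
@[simp] theorem augκ_apply (g : PiTpκ p) : augκ p g = g.right := rfl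

/-- **The augmentation is an OPEN map** (a coordinate projection; contrast `SettingModelAugNotOpen` for the
discrete-Galois model). [cite: MochizukiEtTh2009, §1 p.12] -/
theorem isOpenMap_augκ : IsOpenMap (augκ p) := Semidirect.isOpenMap_right (isInducing_leftRightκ p)

/-- The augmentation is onto `G_{ℚ_p} = G_K` (`K = ℚ_p`). [cite: MochizukiEtTh2009, §1 p.12] -/
theorem range_augκ : (augκ p).toMonoidHom.range = ⊤ :=
  MonoidHom.range_eq_top.mpr fun σ => ⟨SemidirectProduct.inr σ, rfl⟩

/-! ### `Π_X := F̂₂ ⋊_κ G_{ℚ_p}` and the completion map -/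

/-- The action of `G_{ℚ_p}` on `F̂₂` through `κ`: `σ ↦ θ_{κ(σ)}`. [cite: MochizukiEtTh2009, §1 p.12] -/
abbrev actHatκ : GQp p →* MulAut F₂hatT := twistHom.comp (1 : GQp p →* MulAut ZH)

/-- [cite: MochizukiEtTh2009, §1 p.12] -/
theorem actHatκ_apply (σ : GQp p) (x : F₂hatT) : actHatκ p σ x = twist ((1 : GQp p →* MulAut ZH) σ) x := rfl

/-- **`Π_X` of the κ-twisted model**: `F̂₂ ⋊_{θ ∘ κ} G_{ℚ_p}`. [cite: MochizukiEtTh2009, §1 p.12] -/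
abbrev PiHtκ : Type := F₂hatT ⋊[actHatκ p] GQp p

/-- The topology of `Π_X`: induced along `g ↦ (g.left, g.right) ∈ F̂₂ × G_{ℚ_p}`. [cite: MochizukiEtTh2009, §1 p.12] -/
instance instTopologicalSpacePiHtκ : TopologicalSpace (PiHtκ p) :=
  TopologicalSpace.induced (fun g : PiHtκ p => (g.left, g.right)) inferInstance

/-- [cite: MochizukiEtTh2009, §1 p.12] -/
theorem isInducing_leftRightHatκ : IsInducing fun g : PiHtκ p => (g.left, g.right) := ⟨rfl⟩

/-- [cite: MochizukiEtTh2009, §1 p.12] -/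
theorem continuous_leftRightHatκ : Continuous fun g : PiHtκ p => (g.left, g.right) :=
  (isInducing_leftRightHatκ p).continuous

/-- The action on `F̂₂` is jointly continuous. [cite: MochizukiEtTh2009, §1 p.12] -/
theorem continuous_actHatκ : Continuous fun q : GQp p × F₂hatT => actHatκ p q.1 q.2 :=
  continuous_twist_of_isLocallyConstant (fun σ => (1 : GQp p →* MulAut ZH) σ)
    (fun N => by
      have h : (fun σ : GQp p => ZHatLevel.levelChar N ((1 : GQp p →* MulAut ZH) σ)) = fun _ => 1 := by
        funext σ; rw [MonoidHom.one_apply, map_one]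
      rw [h]; exact IsLocallyConstant.const 1)

/-- `Π_X` is a topological group. [cite: MochizukiEtTh2009, §1 p.12] -/
instance instIsTopologicalGroupPiHtκ : IsTopologicalGroup (PiHtκ p) :=
  Semidirect.isTopologicalGroup_of_continuous_action (isInducing_leftRightHatκ p) (continuous_actHatκ p)

/-- `Π_X` is compact. [cite: MochizukiEtTh2009, §1 p.12] -/
instance instCompactSpacePiHtκ : CompactSpace (PiHtκ p) := by
  haveI := compactSpace_GQp p
  exact Semidirect.compactSpace_of (isInducing_leftRightHatκ p)

/-- `Π_X` is Hausdorff. [cite: MochizukiEtTh2009, §1 p.12] -/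
instance instT2SpacePiHtκ : T2Space (PiHtκ p) := by
  haveI : T2Space (GQp p) := krullTopology_t2
  exact Semidirect.t2Space_of (isInducing_leftRightHatκ p)

/-- `Π_X` is totally disconnected. [cite: MochizukiEtTh2009, §1 p.12] -/
instance instTotallyDisconnectedSpacePiHtκ : TotallyDisconnectedSpace (PiHtκ p) := by
  haveI := totallyDisconnectedSpace_GQp p
  exact Semidirect.totallyDisconnectedSpace_of (isInducing_leftRightHatκ p)

/-- `pr₁ : Γ → F̂₂` intertwines the two actions: `pr₁ (θ_{κσ} γ) = θ_{κσ} (pr₁ γ)`. [cite: MochizukiEtTh2009, §1 p.12] -/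
theorem gfpFst_actκ (σ : GQp p) (γ : Gfp) : gfpFst (actκ p σ γ) = actHatκ p σ (gfpFst γ) := rfl

/-- **`Π^tp_X → Π_X`**: `pr₁ ⋊ id`. [cite: MochizukiEtTh2009, §1 p.12] -/
def toHatκ : PiTpκ p →ₜ* PiHtκ p :=
  Semidirect.mapCont (isInducing_leftRightκ p) (isInducing_leftRightHatκ p) gfpFst (gfpFst_actκ p)

/-- [cite: MochizukiEtTh2009, §1 p.12] -/
@[simp] theorem toHatκ_left (g : PiTpκ p) : (toHatκ p g).left = gfpFst g.left := rfl

/-- [cite: MochizukiEtTh2009, §1 p.12] -/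
@[simp] theorem toHatκ_right (g : PiTpκ p) : (toHatκ p g).right = g.right := rfl

/-- `Π^tp_X → Π_X` is injective ("natural injection"). [cite: MochizukiEtTh2009, §1 p.12] -/
theorem toHatκ_injective : Injective (toHatκ p) :=
  Semidirect.mapCont_injective _ _ _ _ gfpFst_injective

/-- The profinite augmentation `Π_X → G_{ℚ_p}`: `g ↦ g.right`. [cite: MochizukiEtTh2009, §1 p.12] -/
def augHatκ : PiHtκ p →ₜ* GQp p := Semidirect.rightHomCont (isInducing_leftRightHatκ p)

/-- [cite: MochizukiEtTh2009, §1 p.12] -/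
@[simp] theorem augHatκ_apply (g : PiHtκ p) : augHatκ p g = g.right := rfl

/-- `augHat ∘ toHat = aug`. [cite: MochizukiEtTh2009, §1 p.12] -/
theorem augHatκ_toHatκ (g : PiTpκ p) : augHatκ p (toHatκ p g) = augκ p g := rfl

/-- **`Π_X = (Π^tp_X)^∧`**: `pr₁ ⋊ id` is a profinite completion (generic `isProfiniteCompletion_mapCont` at
abc-iut-L2-t1's `isProfiniteCompletion_gfpFst`; each `θ_{κσ}` is continuous). [cite: MochizukiEtTh2009, §1 p.12] -/
theorem isProfiniteCompletion_toHatκ : IsProfiniteCompletion (toHatκ p) := by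
  haveI := compactSpace_GQp p
  haveI : T2Space (GQp p) := krullTopology_t2
  haveI := totallyDisconnectedSpace_GQp p
  exact Semidirect.isProfiniteCompletion_mapCont (isInducing_leftRightκ p) (isInducing_leftRightHatκ p) gfpFst
    (gfpFst_actκ p) isProfiniteCompletion_gfpFst (fun σ => (twist ((1 : GQp p →* MulAut ZH) σ)).continuous)

/-! ### The tempered-curve layer -/

/-- **The tempered-curve layer of the κ-twisted model**: `K := ℚ_p`, `Π^tp := Γ ⋊_κ G_{ℚ_p}`,
`Π := F̂₂ ⋊_κ G_{ℚ_p}`, no closed points (as abc-iut-L2-t1's `curve₂`; a cusp datum on the `b`-axis is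
abc-iut-w5-d029's sequel). [cite: MochizukiEtTh2009, §1 p.11] -/
abbrev curveκ : TemperedCurve p where
  K := ⊥
  finiteDimensional_K := inferInstance
  PiTemp := PiTpκ p
  aug := augκ p
  range_aug := by
    rw [IntermediateField.fixingSubgroup_bot]
    exact range_augκ p
  PiHat := PiHtκ p
  toHat := toHatκ p
  isProfiniteCompletion_toHat := isProfiniteCompletion_toHatκ p
  toHat_injective := toHatκ_injective p
  augHat := augHatκ p
  augHat_comp _ := rfl
  Pt := PEmpty
  IsCusp _ := False
  decomp x := x.elim
  isClosed_decomp x := x.elim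
  isOpen_aug_decomp x := x.elim
  inertia_eq_bot x := x.elim
  inertia_equiv_zHat x := x.elim

/-- `Δ^tp_X = Ker(aug) = {g | g.right = 1} = Γ ⋊ 1`. [cite: MochizukiEtTh2009, §1 p.12] -/
theorem mem_deltaTempκ_iff (g : PiTpκ p) : g ∈ (curveκ p).DeltaTemp ↔ g.right = 1 := Iff.rfl

/-- `inl γ ∈ Δ^tp_X`. [cite: MochizukiEtTh2009, §1 p.12] -/
theorem inl_mem_deltaTempκ (γ : Gfp) : (SemidirectProduct.inl γ : PiTpκ p) ∈ (curveκ p).DeltaTemp :=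
  (mem_deltaTempκ_iff p _).mpr rfl

/-- `Ker(Π_X → G_{ℚ_p})` is closed. [cite: MochizukiEtTh2009, §1 p.12] -/
theorem isClosed_ker_rightHomHatκ :
    IsClosed ((SemidirectProduct.rightHom : PiHtκ p →* GQp p).ker : Set (PiHtκ p)) := by
  haveI : T2Space (GQp p) := krullTopology_t2
  have e : ((SemidirectProduct.rightHom : PiHtκ p →* GQp p).ker : Set (PiHtκ p)) =
      (fun g : PiHtκ p => g.right) ⁻¹' {1} := by
    ext g; simp [MonoidHom.mem_ker, SemidirectProduct.rightHom]
  rw [e]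
  exact isClosed_singleton.preimage (Semidirect.continuous_right (isInducing_leftRightHatκ p))

/-- **`Δ_X = F̂₂ ⋊ 1 = Ker(Π_X → G_{ℚ_p})`** (the image of `Γ` in `F̂₂` is dense). [cite: MochizukiEtTh2009, §1 p.12] -/
theorem deltaHatκ_eq : (curveκ p).DeltaHat = (SemidirectProduct.rightHom : PiHtκ p →* GQp p).ker := by
  apply le_antisymm
  · refine Subgroup.topologicalClosure_minimal _ ?_ (isClosed_ker_rightHomHatκ p)
    rintro _ ⟨g, hg, rfl⟩
    rw [MonoidHom.mem_ker]
    change ((curveκ p).toHat g).right = 1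
    exact (mem_deltaTempκ_iff p g).mp hg
  · intro x hx
    rw [MonoidHom.mem_ker] at hx
    change x.right = 1 at hx
    -- `x = inl x.left`, and `inl x.left ∈ closure (inl '' range pr₁) ⊆ closure (toHat '' Δ^tp)`
    have hxe : x = SemidirectProduct.inl x.left := by
      rw [← SemidirectProduct.inl_left_mul_inr_right x, hx, map_one, mul_one]
      rfl
    have hsub : SemidirectProduct.inl '' Set.range (gfpFst : Gfp → F₂hatT) ⊆
        (((curveκ p).DeltaTemp.map (curveκ p).toHat.toMonoidHom : Subgroup (PiHtκ p)) : Set (PiHtκ p)) := by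
      rintro _ ⟨_, ⟨γ, rfl⟩, rfl⟩
      refine ⟨SemidirectProduct.inl γ, inl_mem_deltaTempκ p γ, ?_⟩
      change toHatκ p (SemidirectProduct.inl γ) = SemidirectProduct.inl (gfpFst γ)
      exact SemidirectProduct.ext rfl rfl
    have hmem : (SemidirectProduct.inl x.left : PiHtκ p) ∈ closure (SemidirectProduct.inl '' Set.range gfpFst) :=
      image_closure_subset_closure_image (Semidirect.continuous_inl (isInducing_leftRightHatκ p))
        ⟨x.left, isProfiniteCompletion_gfpFst.denseRange x.left, rfl⟩
    rw [hxe]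
    have key := closure_mono hsub hmem
    rwa [← Subgroup.topologicalClosure_coe] at key

/-- `(x, 1) ∈ Δ_X`. [cite: MochizukiEtTh2009, §1 p.12] -/
theorem inl_mem_deltaHatκ (x : F₂hatT) : (SemidirectProduct.inl x : PiHtκ p) ∈ (curveκ p).DeltaHat := by
  rw [deltaHatκ_eq, MonoidHom.mem_ker, SemidirectProduct.rightHom_inl]

/-- Elements of `Δ_X` have trivial `G_{ℚ_p}`-component. [cite: MochizukiEtTh2009, §1 p.12] -/
theorem right_eq_one_of_mem_deltaHatκ {x : PiHtκ p} (hx : x ∈ (curveκ p).DeltaHat) : x.right = 1 := by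
  rw [deltaHatκ_eq, MonoidHom.mem_ker] at hx
  exact hx

/-- `Δ_X` is normal in `Π_X`. [cite: MochizukiEtTh2009, §1 p.12] -/
theorem deltaHatκ_normal : (curveκ p).DeltaHat.Normal := by
  rw [deltaHatκ_eq]
  infer_instance

/-- **`Δ_X ≃ₜ* F̂₂`** for the κ-twisted model. [cite: MochizukiEtTh2009, §1 p.12] -/
def deltaHatκEquiv : F₂hatT ≃ₜ* (curveκ p).DeltaHat where
  toFun x := ⟨SemidirectProduct.inl x, inl_mem_deltaHatκ p x⟩
  invFun y := (Subtype.val y).left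
  left_inv x := rfl
  right_inv y := by
    apply Subtype.ext
    change SemidirectProduct.inl (y.1.left) = y.1
    rw [← SemidirectProduct.inl_left_mul_inr_right y.1, right_eq_one_of_mem_deltaHatκ p y.2, map_one, mul_one]
    rfl
  map_mul' x y := Subtype.ext (map_mul _ x y)
  continuous_toFun := (Semidirect.continuous_inl (isInducing_leftRightHatκ p)).subtype_mk _
  continuous_invFun := (Semidirect.continuous_left (isInducing_leftRightHatκ p)).comp continuous_subtype_val

/-- **`Δ_X` of the κ-twisted model is profinite free on two generators** (the twist changes the Galois action,
not `Δ_X = F̂₂`), so `IsEtThOrigin.of_free` applies downstream. [cite: MochizukiEtTh2009, §1 p.12] -/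
theorem isFreeProfiniteOnTwo_deltaHatκ : IsFreeProfiniteOnTwo (curveκ p).DeltaHat :=
  IsFreeProfiniteOnTwo.of_continuousMulEquiv (deltaHatκEquiv p) isFreeProfiniteOnTwo_profiniteCompletion_freeGroup

end Literature.AnabelianGeometry.EtaleTheta.SettingModel

end
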